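/-
Copyright (c) 2026 the pub-hodgecm-mathlib formalisation cell (harness21).  Prover seat hodgecm-mathlib-K2E4-p10 (g5), Track B ∕ K2-LIT, h413 =
`stmt-HodgeConjecture-24833`, ENGINE E4, ROW J payer road item 0 (first boxer's note (7)) of the dealer-planner K2E4-plan (g3): CAPACITY answer
2026-09-04T08:02:04Z + HEADS memo `K2/K2E4-plan/g3/heads/HEADS-RowJ-items0-19.K2E4-plan-g3.lean` (sha16 d860d535bb707081) head (h0), statement verbatim.
-/
import Literature.NumberTheory.Rogawski1990.SemilocalCharactersLinIndep     -- ★ `ArchTestKc`, `archTestKc_iff` (+ ★ `cmCompactFactor`, `archPart`, `archToAdelic`)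
import Literature.NumberTheory.Rogawski1990.ArchimedeanTransfer             -- ★ `ArchSmooth`, `archSmooth_iff`
import Literature.NumberTheory.Automorphic.UnitaryGroupArchCharacter        -- ★ `UnitaryGroup.archProjUForm`, `archProjUForm_ker`
import HarnessLib

/-!
# K2·E4 — `K2E4ArchTestKcBridge` (ROW J item 0): THE CELL'S ARCHIMEDEAN TEST CLASS `ArchTestKc` IS `ArchSmooth` + BI-`ker(archProjUForm)`-INVARIANCE

Track B ∕ K2-LIT, crux h413 = `stmt-HodgeConjecture-24833`, route of record `HCCMUnconditional`; cell `hodgecm-mathlib`, squad K2, ENGINE E4 (dealer-planner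
K2E4-plan (g3), research row J `sig_K2E4ArchCharIdentityOfRecord`, payer-road item 0).  Prover seat `hodgecm-mathlib-K2E4-p10` (g5).  THEOREMS ONLY (no `def`, no
`instance`, no notation, no named-fact hypothesis, no `sorry`); lane `--supports stmt-HodgeConjecture-24833 --as helper` (count-neutral).  Closes no socket.

THE MATHEMATICS [Rogawski1990, §14.2 p. 233; BorelJacquet1979, §4.1].  `G′_∞ = U(H)(L⁺ ⊗ ℝ)` (★ `UnitaryGroup.arch`), `K_c ≤ G′_∞` the compact archimedean factor away
from the CM type `ι` = the KERNEL of the archimedean projection ★ `UnitaryGroup.archProjUForm L ι H T hT : G′_∞ →* U(2,1)` (★ `archProjUForm_ker`: the kernel of ★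
`archProjU21EmbCM`), whose image under ★ `archToAdelic` (`g ↦ (g, 1)`) is the adelic compact factor ★ `cmCompactFactor L ι H T hT` (★ `cmCompactFactor_eq`).  The cell's
archimedean test class ★ `ArchTestKc L ι H T hT φ` (letter ★ `SemilocalCharactersLinIndep` §1; RULING (V31) «`f′_∞ = f_ι ⊗ e_{K_c}`») is the conjunction of
(i) `φ` is the restriction of a continuous compactly supported arch-smooth function on `GL₃(L ⊗ ℝ)` — which IS ★ `ArchSmooth L 3 H φ` token for token — and
(ii)∕(iii) right∕left invariance of `φ` under `archPart k` for `k ∈ cmCompactFactor`.  Since `archPart (archToAdelic k) = k` (★ `archPart_archToAdelic`), (ii)∕(iii) say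
exactly that `φ` is bi-invariant under `K_c = {k : archProjUForm k = 1}` — the form in which ROW J (`sig_K2E4ArchCharIdentityOfRecord`) states its `a`-hypotheses.

THE LEAN TEXT.  §1 the dealt head **`archSmooth_and_biInvariant_of_archTestKc (L ι H T hT φ) (hφ : ArchTestKc L ι H T hT φ) :
ArchSmooth L 3 H φ ∧ ∀ k, UnitaryGroup.archProjUForm L ι H T hT k = 1 → ∀ g, φ (g * k) = φ g ∧ φ (k * g) = φ g`** (HEADS memo (h0) VERBATIM); §2 the converse
`archTestKc_of_archSmooth_of_biInvariant` and the `Iff` `archTestKc_iff_archSmooth_and_biInvariant` (so organ 1 of the payer can move in either direction), plus the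
kernel-membership spellings `archToAdelic_mem_cmCompactFactor_of_archProjUForm_eq_one` ∕ `archProjUForm_archPart_eq_one_of_mem_cmCompactFactor`.
HONEST LABEL: HC_CM is proved only modulo the 7 printed citations (2 remaining named inputs: hLiu418 = `stmt-HodgeConjecture-24832`, h413 = `stmt-HodgeConjecture-24833`)
until rung 0 closes; this file asserts no named fact and closes no socket.
References: [Rogawski1990] §14.2 p. 233 · [BorelJacquet1979] §4.1.
-/

set_option autoImplicit false
-- the mandated namespace repeats the single-problem summit's segment (`HodgeConjecture.HodgeConjecture`)
set_option linter.dupNamespace false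

noncomputable section

open NumberField
open Literature.NumberTheory.Automorphic Literature.NumberTheory.Automorphic.UnitaryGroup
open Literature.NumberTheory.Automorphic.UnitaryGroup.CotangentForms
open Literature.NumberTheory.Rogawski1990
open scoped Matrix MatrixGroups

namespace Summit.HodgeConjecture.HodgeConjecture.Cruxes.H413.K2E4ArchTestKcBridge

variable (L : Type) [Field L] [NumberField L] [IsCMField L] (ι : L →+* ℂ)
  (H : Matrix (Fin 3) (Fin 3) L) (T : GL (Fin 3) ℂ)
  (hT : (T : Matrix (Fin 3) (Fin 3) ℂ)ᴴ * H.map ι * (T : Matrix (Fin 3) (Fin 3) ℂ) = Literature.Geometry.ComplexHyperbolic.BallModel.J)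

/-! ## §0 Kernel membership: `archProjUForm k = 1 ↔ archToAdelic k ∈ cmCompactFactor` -/

/-- An archimedean element with trivial `ι`-projection, `archProjUForm k = 1`, lies — as `(k, 1) = archToAdelic k` — in the adelic compact factor
`cmCompactFactor = (ker archProjU21EmbCM).map archToAdelic` (★ `archProjUForm_ker`, ★ `cmCompactFactor_eq`). [cite: BorelJacquet1979, §4.1] -/
theorem archToAdelic_mem_cmCompactFactor_of_archProjUForm_eq_one
    {k : UnitaryGroup.arch (↥(maximalRealSubfield L)) L (IsCMField.complexConj L) 3 H} (hk : UnitaryGroup.archProjUForm L ι H T hT k = 1) :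
    archToAdelic (↥(maximalRealSubfield L)) L (IsCMField.complexConj L) 3 H k ∈ cmCompactFactor L ι H T hT := by
  have hk' : k ∈ (archProjU21EmbCM L H ι T (formCongr_eq_of_conjTranspose L ι H T hT)).ker := by
    rw [← archProjUForm_ker L ι H T hT, MonoidHom.mem_ker]
    exact hk
  rw [cmCompactFactor_eq]
  exact Subgroup.mem_map_of_mem _ hk'

/-- Conversely the archimedean part of an element of `cmCompactFactor` has trivial `ι`-projection: `archProjUForm (archPart k) = 1`
(★ `cmCompactFactor_eq`, ★ `archPart_archToAdelic`, ★ `archProjUForm_ker`). [cite: BorelJacquet1979, §4.1] -/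
theorem archProjUForm_archPart_eq_one_of_mem_cmCompactFactor
    {k : (adelicGroupData (↥(maximalRealSubfield L)) L (IsCMField.complexConj L) 3 H).Adelic} (hk : k ∈ cmCompactFactor L ι H T hT) :
    UnitaryGroup.archProjUForm L ι H T hT (archPart (↥(maximalRealSubfield L)) L (IsCMField.complexConj L) 3 H k) = 1 := by
  rw [cmCompactFactor_eq] at hk
  obtain ⟨a, ha, rfl⟩ := Subgroup.mem_map.1 hk
  rw [archPart_archToAdelic, ← MonoidHom.mem_ker, archProjUForm_ker L ι H T hT]
  exact ha

/-! ## §1 The dealt head (HEADS memo (h0), statement verbatim): `ArchTestKc ⟹ ArchSmooth ∧ bi-K_c-invariance` -/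

/-- **ROW J item 0 — the cell's archimedean test class feeds ROW J's `a`-hypotheses.**  If `φ ∈ ArchTestKc L ι H T hT` then (i) `φ` is `ArchSmooth L 3 H`
(the first clause of ★ `archTestKc_iff` IS ★ `archSmooth_iff` token for token) and (ii) `φ` is bi-invariant under the compact factor
`K_c = ker (archProjUForm L ι H T hT)`: `φ (g * k) = φ g` and `φ (k * g) = φ g` whenever `archProjUForm k = 1` (clauses (ii)∕(iii) of ★ `ArchTestKc` at
`archToAdelic k ∈ cmCompactFactor`, read back through `archPart (archToAdelic k) = k`, ★ `archPart_archToAdelic`).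
[cite: Rogawski1990, §14.2 p. 233] [cite: BorelJacquet1979, §4.1] -/
theorem archSmooth_and_biInvariant_of_archTestKc
    (φ : UnitaryGroup.arch (↥(maximalRealSubfield L)) L (IsCMField.complexConj L) 3 H → ℂ)
    (hφ : ArchTestKc L ι H T hT φ) :
    ArchSmooth L 3 H φ ∧
      ∀ k : UnitaryGroup.arch (↥(maximalRealSubfield L)) L (IsCMField.complexConj L) 3 H,
        UnitaryGroup.archProjUForm L ι H T hT k = 1 →
          ∀ g : UnitaryGroup.arch (↥(maximalRealSubfield L)) L (IsCMField.complexConj L) 3 H, φ (g * k) = φ g ∧ φ (k * g) = φ g := by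
  obtain ⟨hsm, hφr, hφl⟩ := hφ
  refine ⟨hsm, fun k hk g => ?_⟩
  have hmem := archToAdelic_mem_cmCompactFactor_of_archProjUForm_eq_one L ι H T hT hk
  have h1 := hφr _ hmem g
  have h2 := hφl _ hmem g
  rw [archPart_archToAdelic] at h1 h2
  exact ⟨h1, h2⟩

/-- (i) alone: an `ArchTestKc` function is `ArchSmooth` (definitionally the first clause). [cite: Rogawski1990, §14.2 p. 233] -/
theorem archSmooth_of_archTestKc
    {φ : UnitaryGroup.arch (↥(maximalRealSubfield L)) L (IsCMField.complexConj L) 3 H → ℂ} (hφ : ArchTestKc L ι H T hT φ) :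
    ArchSmooth L 3 H φ :=
  hφ.1

/-- (ii) alone, in kernel language: an `ArchTestKc` function is RIGHT-invariant under `ker (archProjUForm)`. [cite: Rogawski1990, §14.2 p. 233] -/
theorem apply_mul_eq_of_archTestKc_of_mem_ker
    {φ : UnitaryGroup.arch (↥(maximalRealSubfield L)) L (IsCMField.complexConj L) 3 H → ℂ} (hφ : ArchTestKc L ι H T hT φ)
    {k : UnitaryGroup.arch (↥(maximalRealSubfield L)) L (IsCMField.complexConj L) 3 H} (hk : k ∈ (UnitaryGroup.archProjUForm L ι H T hT).ker)
    (g : UnitaryGroup.arch (↥(maximalRealSubfield L)) L (IsCMField.complexConj L) 3 H) :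
    φ (g * k) = φ g :=
  ((archSmooth_and_biInvariant_of_archTestKc L ι H T hT φ hφ).2 k ((MonoidHom.mem_ker).1 hk) g).1

/-- (iii) alone, in kernel language: an `ArchTestKc` function is LEFT-invariant under `ker (archProjUForm)`. [cite: Rogawski1990, §14.2 p. 233] -/
theorem apply_mul_eq_of_archTestKc_of_mem_ker'
    {φ : UnitaryGroup.arch (↥(maximalRealSubfield L)) L (IsCMField.complexConj L) 3 H → ℂ} (hφ : ArchTestKc L ι H T hT φ)
    {k : UnitaryGroup.arch (↥(maximalRealSubfield L)) L (IsCMField.complexConj L) 3 H} (hk : k ∈ (UnitaryGroup.archProjUForm L ι H T hT).ker)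
    (g : UnitaryGroup.arch (↥(maximalRealSubfield L)) L (IsCMField.complexConj L) 3 H) :
    φ (k * g) = φ g :=
  ((archSmooth_and_biInvariant_of_archTestKc L ι H T hT φ hφ).2 k ((MonoidHom.mem_ker).1 hk) g).2

/-! ## §2 The converse and the `Iff` -/

/-- **Converse**: an `ArchSmooth` function bi-invariant under `K_c = ker (archProjUForm)` is in `ArchTestKc` — for `k ∈ cmCompactFactor` the archimedean part
`archPart k` has `archProjUForm (archPart k) = 1` (§0). [cite: Rogawski1990, §14.2 p. 233] [cite: BorelJacquet1979, §4.1] -/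
theorem archTestKc_of_archSmooth_of_biInvariant
    (φ : UnitaryGroup.arch (↥(maximalRealSubfield L)) L (IsCMField.complexConj L) 3 H → ℂ)
    (hsm : ArchSmooth L 3 H φ)
    (hinv : ∀ k : UnitaryGroup.arch (↥(maximalRealSubfield L)) L (IsCMField.complexConj L) 3 H,
        UnitaryGroup.archProjUForm L ι H T hT k = 1 →
          ∀ g : UnitaryGroup.arch (↥(maximalRealSubfield L)) L (IsCMField.complexConj L) 3 H, φ (g * k) = φ g ∧ φ (k * g) = φ g) :
    ArchTestKc L ι H T hT φ := by
  refine ⟨hsm, fun k hk a => ?_, fun k hk a => ?_⟩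
  · exact (hinv _ (archProjUForm_archPart_eq_one_of_mem_cmCompactFactor L ι H T hT hk) a).1
  · exact (hinv _ (archProjUForm_archPart_eq_one_of_mem_cmCompactFactor L ι H T hT hk) a).2

/-- **`ArchTestKc ↔ ArchSmooth ∧ bi-K_c-invariance`** (`K_c = ker (archProjUForm L ι H T hT)`): the cell's archimedean test class in the language of ROW J.
[cite: Rogawski1990, §14.2 p. 233] [cite: BorelJacquet1979, §4.1] -/
theorem archTestKc_iff_archSmooth_and_biInvariant
    (φ : UnitaryGroup.arch (↥(maximalRealSubfield L)) L (IsCMField.complexConj L) 3 H → ℂ) :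
    ArchTestKc L ι H T hT φ ↔
      ArchSmooth L 3 H φ ∧
        ∀ k : UnitaryGroup.arch (↥(maximalRealSubfield L)) L (IsCMField.complexConj L) 3 H,
          UnitaryGroup.archProjUForm L ι H T hT k = 1 →
            ∀ g : UnitaryGroup.arch (↥(maximalRealSubfield L)) L (IsCMField.complexConj L) 3 H, φ (g * k) = φ g ∧ φ (k * g) = φ g :=
  ⟨archSmooth_and_biInvariant_of_archTestKc L ι H T hT φ, fun h => archTestKc_of_archSmooth_of_biInvariant L ι H T hT φ h.1 h.2⟩

/-- The same `Iff` with the invariance stated over the SUBGROUP `(archProjUForm L ι H T hT).ker`. [cite: Rogawski1990, §14.2 p. 233] -/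
theorem archTestKc_iff_archSmooth_and_forall_mem_ker
    (φ : UnitaryGroup.arch (↥(maximalRealSubfield L)) L (IsCMField.complexConj L) 3 H → ℂ) :
    ArchTestKc L ι H T hT φ ↔
      ArchSmooth L 3 H φ ∧
        ∀ k ∈ (UnitaryGroup.archProjUForm L ι H T hT).ker,
          ∀ g : UnitaryGroup.arch (↥(maximalRealSubfield L)) L (IsCMField.complexConj L) 3 H, φ (g * k) = φ g ∧ φ (k * g) = φ g := by
  rw [archTestKc_iff_archSmooth_and_biInvariant]
  simp only [MonoidHom.mem_ker]

end Summit.HodgeConjecture.HodgeConjecture.Cruxes.H413.K2E4ArchTestKcBridge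

end
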